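import Summits.CriticalPhenomena.PercolationContinuityZ3.Theorems.PercNearOneGluingAdditiveGluingEngineFull
import Summits.CriticalPhenomena.PercolationContinuityZ3.Theorems.PercNearOneGluingAdditiveGluingPeelPairGamma
import HarnessLib

/-! # Crux `PercNearOneGluing.AdditiveGluing` (stmt-CriticalPhenomena-4576), line `peel`, stub `stub_bystanderReach_c5` —
# the bystander σ-identity R (law of total probability over the open star of the bystander)

Support file (`--supports stmt-CriticalPhenomena-4576`); no definitions, no named facts.

`μ_u = prodBernoulli u` (bond percolation on `Fin n`), a block `T`, a bystander `x ∉ T`, a target `b ≠ x`.  Partition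
the event "the block `insert x T` reaches `b`" by the set `B` of open neighbours of `x` (the layer event
`L_B = {ω | ∀ y, y ∈ B ↔ (y ∉ {x} ∧ ∃ o ∈ {x}, s(o, y) ∈ ω)}` of `stub_sigmaLaw` with `O = {x}`):
`μ_u(insert x T ↔ b) = Σ_B μ_u(L_B) · μ_{q_B}(T ∪ B ↔ b)`, where `q_B` is `u` with the star of `x` killed and the
pairs inside `B` glued.  Proof: `sigmaRec_partition` (partition by the layer), `stub_sigmaGeometry` with `O = {x}`
(on `L_B`, `x ↔ b` in `ω` iff `B ↔ b` in `Ψ_B ω`, and `v ↔ b` in `ω` iff `v ↔ b` in `Ψ_B ω` for `v ∈ T`), and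
`stub_sigmaLaw` with `O = {x}` (the law of `Ψ_B` on `L_B`), after `u/{x} = u` (`peelGlue_glue_singleton`).
[cite: KozmaNitzan2024, §3.2 pp. 13–14 (the `σ_B`-decomposition)]
-/

namespace Summit.CriticalPhenomena.PercolationContinuityZ3.Theorems

open MeasureTheory Set
open Literature.Probability.LatticeModels (prodBernoulli)
open Literature.Probability.Percolation (BondConfig openConn openConnIn openGraph openCluster)
open scoped BigOperators Classical

noncomputable section

section BystanderReach

variable {n : ℕ}

/-- **Pointwise geometry of the bystander layer.**  If `B` is exactly the set of open neighbours of `x` in `ω`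
(`x ∉ T`, `b ≠ x`), then `insert x T` reaches `b` in `ω` iff `T ∪ B` reaches `b` in the glued off-star
configuration `Ψ_B ω = {e ∈ ω | x ∉ e} ∪ {non-loop pairs inside B}` (`stub_sigmaGeometry` with `O = {x}`).
[cite: KozmaNitzan2024, §3.2 p. 14] -/
theorem bystR_geometry (T B : Finset (Fin n)) (x b : Fin n) (hxT : x ∉ T) (hbx : b ≠ x)
    (ω : BondConfig (Fin n))
    (hL : ∀ y : Fin n, y ∈ B ↔ (y ∉ ({x} : Finset (Fin n)) ∧ ∃ o ∈ ({x} : Finset (Fin n)), s(o, y) ∈ ω)) :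
    ω ∈ (⋃ v ∈ insert x T, openConn v b : Set (BondConfig (Fin n))) ↔
      ({e | e ∈ ω ∧ ∀ y ∈ e, y ∉ ({x} : Finset (Fin n))} ∪ {e | (∀ y ∈ e, y ∈ B) ∧ ¬ e.IsDiag} :
          BondConfig (Fin n)) ∈
        (⋃ v ∈ T ∪ B, openConn v b : Set (BondConfig (Fin n))) := by
  have hclique : ∀ o₁ ∈ ({x} : Finset (Fin n)), ∀ o₂ ∈ ({x} : Finset (Fin n)), o₁ ≠ o₂ → s(o₁, o₂) ∈ ω := by
    intro o₁ h₁ o₂ h₂ hne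
    exact absurd ((Finset.mem_singleton.1 h₁).trans (Finset.mem_singleton.1 h₂).symm) hne
  obtain ⟨h1, h2⟩ := stub_sigmaGeometry n ({x} : Finset (Fin n)) B ω hL hclique
  have hxb := h1 {b} (by simp [hbx.symm])
  simp only [Finset.set_biUnion_singleton] at hxb
  rw [Finset.set_biUnion_insert, Finset.set_biUnion_union, Set.mem_union, Set.mem_union, hxb, or_comm]
  refine or_congr ?_ Iff.rfl
  simp only [Set.mem_iUnion, exists_prop]
  refine exists_congr fun v => and_congr_right fun hv => ?_
  refine h2 v b (fun h => ?_) (by simp [hbx])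
  rw [Finset.mem_singleton] at h
  subst h
  exact hxT hv

end BystanderReach

/-- **σ-identity R (bystander reach)** — registered stub `stub_bystanderReach_c5` of crux stmt-CriticalPhenomena-4576
(line `peel`): the law of total probability over the open star `B` of the bystander `x`,
`μ_u(insert x T ↔ b) = Σ_B μ_u(open star of x = B) · μ_{q_B}(T ∪ B ↔ b)` with `q_B` = `u` with the star of `x`
killed and `B` glued.  Partition by the layer (`sigmaRec_partition`), rewrite the event through `Ψ_B` on each layer
(`bystR_geometry`), factor (`stub_sigmaLaw` with `O = {x}`, `u/{x} = u`).
[cite: KozmaNitzan2024, §3.2 pp. 13–14 (the `σ_B`-decomposition)] -/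
theorem stub_bystanderReach_c5 :
    ∀ (n : ℕ) (u : Sym2 (Fin n) → unitInterval) (T : Finset (Fin n)) (x b : Fin n),
      x ∉ T → b ≠ x →
      (prodBernoulli u).real (⋃ v ∈ insert x T, openConn v b)
        = ∑ B : Finset (Fin n),
            (prodBernoulli u).real
                {ω : BondConfig (Fin n) | ∀ y : Fin n, y ∈ B ↔ (y ∉ ({x} : Finset (Fin n)) ∧
                  ∃ o ∈ ({x} : Finset (Fin n)), s(o, y) ∈ ω)}
              * (prodBernoulli (fun e : Sym2 (Fin n) =>
                    if (∀ y ∈ e, y ∈ B) ∧ ¬ e.IsDiag then 1 else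
                      if (∃ y ∈ e, y ∈ ({x} : Finset (Fin n))) then 0 else u e)).real
                  (⋃ v ∈ T ∪ B, openConn v b) := by
  intro n u T x b hxT hbx
  rw [sigmaRec_partition u ({x} : Finset (Fin n))]
  refine Finset.sum_congr rfl fun B _ => ?_
  have hlaw := stub_sigmaLaw n u {x} B (⋃ v ∈ T ∪ B, openConn v b)
  rw [peelGlue_glue_singleton u x] at hlaw
  rw [← hlaw]
  congr 1
  ext ω
  simp only [Set.mem_inter_iff, Set.mem_setOf_eq]
  exact and_congr_right fun hL => bystR_geometry T B x b hxT hbx ω hL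

end

end Summit.CriticalPhenomena.PercolationContinuityZ3.Theorems
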